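import Literature.AlgebraicGeometry.Frobenioids.PerfFactorialWeakGroupSaturated
import Literature.AlgebraicGeometry.Frobenioids.PiNatFactorization
import Literature.AlgebraicGeometry.Frobenioids.PiNatPerfFactorialWeak
import Literature.AlgebraicGeometry.Frobenioids.PerfFactorialWeakFinite
import Literature.AlgebraicGeometry.Frobenioids.FactorizationTransport
import Mathlib.Data.Fintype.EquivFin
import Mathlib.Logic.Equiv.Fintype
import HarnessLib

/-!
# [FrdI] Def. 2.4 (i) AS PRINTED for `∏_J ℤ≥0`: perf-factorial iff `J` is finite; and the printed notion is
# invariant along group-saturated perf-dense submonoids (so the dichotomy descends to `Div⁺ ⊆ DIV⁺`)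

Mochizuki, *The geometry of Frobenioids I*, Kyushu J. Math. **62** (2008), Def. 2.4 (i), kurims p. 47, clause (d)
("If `a ∈ M^pf_factor` and `b ∈ M^pf` satisfy `Supp(a) ⊆ Supp(b)`, then `a ∈ M^pf`")
[cite: MochizukiFrdI2008, Def. 2.4(i) p.47]; Mochizuki, *The étale theta function …*, Publ. RIMS **45** (2009),
Prop. 3.4 (i) PDF p. 74 [cite: MochizukiEtTh2009, Prop 3.4 p.74].

abc-iut cell, W6 cone prover abc-iut-w6-d057 (row EtTh:Prop3.4(i), negative twin), extending finding F-L2d2-1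
(abc-iut-L2-d2; kernel witness `PerfFactorialProductCounterexample.not_isPerfFactorial_multiplicative_pi_nat` for
`J = ℕ`).  PROOF-ONLY (theorems only):

* **`PiNat.not_isPerfFactorial_of_infinite`** — for EVERY INFINITE `J`, `∏_J ℤ≥0` is NOT perf-factorial as printed:
  along an embedding `ι : ℕ ↪ J` the family `(e_{ι i}^{1/(i+2)})_i ∈ ∏_𝔮 M^pf_𝔮` is supported inside
  `Supp(𝟙)` but is no factorization (its denominators are unbounded; uses abc-iut-L1-t2/L2-d2's coordinatewise
  computation `PiNat.factorMap_apply`);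
* **`PiNat.isPerfFactorial_of_finite`** — for FINITE `J` it IS perf-factorial as printed (weak + finitely supported
  factorizations, `IsPerfFactorialWeak.isPerfFactorial_of_supp_finite`); whence `PiNat.isPerfFactorial_iff_finite`;
* **`GroupSaturatedSubmonoid.isPerfFactorial_iff`** — for a group-saturated, perf-dense submonoid `M ⊆ P` of a
  divisorial `P` with `ℤ`-monoprime components, `M` is perf-factorial (printed) iff `P` is (conditions (c)(d)
  live on `M^pf ≅ P^pf`, `Factorization.Cond.of_mulEquiv`; (a)(b) hold on both sides).

HONEST FRAMING: classical monoid algebra about a definition; the cell's reading of [EtTh] §3 uses the WEAK notion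
(F-L2d2-1/F-L2d2-2); nothing here bears on [IUTchIII] Cor. 3.12.
-/

noncomputable section

namespace Literature.AlgebraicGeometry.Frobenioids

open Function Literature.AnabelianGeometry.EtaleTheta

universe u

namespace PiNat

variable {J : Type u}

section Dec

variable [DecidableEq J]

/-- The roots `(e_j)^{1/n}` lie in `M_J^pf_{𝔮_j}`. [cite: MochizukiFrdI2008, §0 p.12] -/
theorem mk_single_one_mem_submonoid_q (j : J) (n : ℕ+) :
    Perfection.mk (single j 1) n ∈ (q j).submonoid :=
  mem_submonoid_q_iff.2 ⟨1, n, rfl⟩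

/-- The factorization of `𝟙 = (1, 1, 1, …)` has FULL support: at `𝔮_j` it is `e_j ⊗ 1 ≠ 0`.
[cite: MochizukiFrdI2008, Def. 2.4(i) p.47] -/
theorem factorMap_of_const_one_ne_one (j : J) :
    factorMap (Multiplicative (J → ℕ)) (Perfection.of _ (Multiplicative.ofAdd fun _ : J => (1 : ℕ))) (q j) ≠ 1 := by
  rw [factorMap_apply]
  intro h
  have h1 : pfAtCoord (Perfection.of _ (Multiplicative.ofAdd fun _ : J => (1 : ℕ))) j = 1 :=
    Realification.of_injective (isMonoprime_pfAt (q j)) (by rw [h, map_one])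
  have h2 := congrArg (fun z : PfAt (Multiplicative (J → ℕ)) (q j) => (z : Perfection (Multiplicative (J → ℕ)))) h1
  change Perfection.map (proj j) (Perfection.of _ (Multiplicative.ofAdd fun _ : J => (1 : ℕ))) = 1 at h2
  rw [Perfection.of_apply, Perfection.map_mk, proj_apply, Perfection.mk_eq_one_iff_of_isSharp isSharp,
    single_eq_one_iff] at h2
  exact one_ne_zero h2

end Dec

/-- **For infinite `J`, `∏_J ℤ≥0` is NOT perf-factorial in the printed sense of [FrdI] Def. 2.4 (i)**: clause (d)
fails for the family `a = (e_{ι i}^{1/(i+2)})_{i ∈ ℕ}` (other components trivial) against `b = 𝟙` — a factorization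
`c = m^{1/d}` with these components would need `(d + 2) · m_{ι d} = d`.  (F-L2d2-1 for arbitrary infinite index
sets; the `J = ℕ` case is `PerfFactorialProductCounterexample.not_isPerfFactorial_multiplicative_pi_nat`.)
[cite: MochizukiFrdI2008, Def. 2.4(i) p.47] -/
theorem not_isPerfFactorial_of_infinite [Infinite J] : ¬ IsPerfFactorial (Multiplicative (J → ℕ)) := by
  classical
  intro h
  let ι : ℕ ↪ J := Infinite.natEmbedding J
  have hqι : Injective fun i : ℕ => q (ι i) := q_bijective.1.comp ι.injective
  -- the test family
  let x : PfFactor (Multiplicative (J → ℕ)) := fun 𝔮 =>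
    if hq : ∃ i : ℕ, q (ι i) = 𝔮 then
      ⟨Perfection.mk (single (ι hq.choose) 1) ⟨hq.choose + 2, by omega⟩,
        hq.choose_spec ▸ mk_single_one_mem_submonoid_q (ι hq.choose) ⟨hq.choose + 2, by omega⟩⟩
    else 1
  let b : Perfection (Multiplicative (J → ℕ)) := Perfection.of _ (Multiplicative.ofAdd fun _ : J => (1 : ℕ))
  have hsupp : supp (pfFactorToRlfFactor _ x) ⊆ supp (factorMap _ b) := by
    intro 𝔮 _
    obtain ⟨j, rfl⟩ := exists_eq_q 𝔮
    exact factorMap_of_const_one_ne_one j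
  obtain ⟨c, hc⟩ := h.mem_range_of_supp_subset x b hsupp
  obtain ⟨⟨m, d⟩, rfl⟩ := Perfection.mk_surjective c
  -- compare the `𝔮_{ι d}`-components
  have hq : ∃ i : ℕ, q (ι i) = q (ι (d : ℕ)) := ⟨d, rfl⟩
  have hk : hq.choose = (d : ℕ) := hqι hq.choose_spec
  have hxval : (x (q (ι (d : ℕ))) : Perfection (Multiplicative (J → ℕ))) =
      Perfection.mk (single (ι hq.choose) 1) ⟨hq.choose + 2, by omega⟩ := by
    simp only [x, dif_pos hq]
  have hcomp := congrFun hc (q (ι (d : ℕ)))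
  rw [factorMap_apply, pfFactorToRlfFactor_apply] at hcomp
  have hcoord : (pfAtCoord (Perfection.mk m d) (ι (d : ℕ)) : Perfection (Multiplicative (J → ℕ))) =
      (x (q (ι (d : ℕ))) : Perfection _) :=
    congrArg Subtype.val (Realification.of_injective (isMonoprime_pfAt _) hcomp)
  rw [hxval] at hcoord
  change Perfection.map (proj (ι (d : ℕ))) (Perfection.mk m d) = _ at hcoord
  rw [Perfection.map_mk, proj_apply, Perfection.mk_eq_mk_iff] at hcoord
  obtain ⟨N, hN⟩ := hcoord
  have hN' := congrArg (fun f => coeff f (ι (d : ℕ))) hN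
  simp only [coeff_pow, coeff_single_same, hk] at hN'
  -- `N * (d + 2) * m_{ι d} = N * d`: impossible
  have hNpos : 0 < (N : ℕ) := N.pos
  have hdpos : 0 < (d : ℕ) := d.pos
  have : (N : ℕ) * ((d : ℕ) + 2) * coeff m (ι (d : ℕ)) = (N : ℕ) * (d : ℕ) := by
    simpa [PNat.mk_coe, mul_assoc] using hN'
  rcases Nat.eq_zero_or_pos (coeff m (ι (d : ℕ))) with h0 | hpos
  · rw [h0, mul_zero] at this
    have : (N : ℕ) * (d : ℕ) = 0 := this.symm
    exact absurd this (Nat.mul_pos hNpos hdpos).ne'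
  · have hle : (N : ℕ) * ((d : ℕ) + 2) ≤ (N : ℕ) * ((d : ℕ) + 2) * coeff m (ι (d : ℕ)) :=
      Nat.le_mul_of_pos_right _ hpos
    rw [this] at hle
    have : (N : ℕ) * ((d : ℕ) + 2) > (N : ℕ) * (d : ℕ) := Nat.mul_lt_mul_of_pos_left (by omega) hNpos
    omega

/-- `Prime(M_J^pf)` is in bijection with `J`; in particular it is finite when `J` is. [cite: MochizukiFrdI2008, §0 p.12] -/
theorem finite_primes_perfection [Finite J] : Finite (Primes (Perfection (Multiplicative (J → ℕ)))) := by
  classical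
  exact Finite.of_surjective _ q_bijective.2

/-- **For finite `J`, `∏_J ℤ≥0` IS perf-factorial as printed** (weakly perf-factorial with finitely supported
factorizations). [cite: MochizukiFrdI2008, Def. 2.4(i) p.47] -/
theorem isPerfFactorial_of_finite [Finite J] : IsPerfFactorial (Multiplicative (J → ℕ)) := by
  haveI := finite_primes_perfection (J := J)
  exact isPerfFactorialWeak'.isPerfFactorial_of_supp_finite fun _ => Set.toFinite _

/-- **`∏_J ℤ≥0` is perf-factorial (printed sense) iff `J` is finite.** [cite: MochizukiFrdI2008, Def. 2.4(i) p.47] -/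
theorem isPerfFactorial_iff_finite : IsPerfFactorial (Multiplicative (J → ℕ)) ↔ Finite J := by
  constructor
  · intro h
    by_contra hJ
    haveI : Infinite J := not_finite_iff_infinite.mp hJ
    exact not_isPerfFactorial_of_infinite h
  · intro hJ
    haveI := hJ
    exact isPerfFactorial_of_finite

end PiNat

/-! ### The printed notion along group-saturated perf-dense submonoids -/

namespace GroupSaturatedSubmonoid

variable {P : Type u} [CommMonoid P] {M : Submonoid P}

/-- **`M` perf-factorial (printed) ⟺ `P` perf-factorial (printed)** for a group-saturated, perf-dense submonoid
`M ⊆ P` of a divisorial `P` with `ℤ`-monoprime components: clauses (c)(d) concern `M^pf ≅ P^pf` only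
(`Factorization.Cond.of_mulEquiv`), and (a)(b) hold for both (`isDivisorial`, `isZMonoprime_submonoid_primes`).
[cite: MochizukiFrdI2008, Def. 2.4(i) p.47] -/
theorem isPerfFactorial_iff (hP : IsDivisorial P) (hZ : ∀ 𝔮 : Primes P, IsZMonoprime ↥𝔮.submonoid)
    (hsat : IsGroupSaturated M) (hdense : ∀ x : P, x ∈ perfSaturation M) :
    IsPerfFactorial M ↔ IsPerfFactorial P := by
  obtain ⟨e⟩ := nonempty_perfectionEquiv hdense
  constructor
  · intro h
    exact IsPerfFactorial.of_cond hP (fun 𝔮 => IsMonoprime.ofZ (hZ 𝔮)) (Factorization.Cond.of_mulEquiv e h.cond)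
  · intro h
    exact IsPerfFactorial.of_cond (isDivisorial hP hsat)
      (fun 𝔭 => IsMonoprime.ofZ (isZMonoprime_submonoid_primes hP.isSharp hZ hsat hdense 𝔭))
      (Factorization.Cond.of_mulEquiv e.symm h.cond)

end GroupSaturatedSubmonoid

end Literature.AlgebraicGeometry.Frobenioids

end
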